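import Mathlib
import Literature.Analysis.Complex.CauchyPompeiu

/-!
# Conjugate Beltrami equation for `G = ½ (1 - i j) ∂ₓ f`

Stub `helper_conjugateBeltrami` of line `Sketch` (crux stmt-SmoothPoincare4-7826).

Let `f : ℂ → ℂ` be smooth and quasi-holomorphic for a smooth field `j` of complex structures on
the target, i.e. `j η ∘ j η = -1` and `df_η (i v) = j η (df_η v)`. Write `g = ∂ₓ f`
(`g η = fderiv ℝ f η 1`), so that `∂_y f = j g`. Symmetry of second derivatives gives
`∂_y g = ∂ₓ (j g) = (∂ₓ j) g + j (∂ₓ g)`, and for `G = ½ (g - i j g)` a direct computation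
(using `j ∘ j = -1`) yields the conjugate Beltrami equation
`∂̄ G = ½ (∂ₓ G + i ∂_y G) = ¼ ((∂_y j) g + j ((∂ₓ j) g))`.
This file proves the smoothness of `G` and this identity; it is pure calculus.
-/

set_option linter.dupNamespace false

noncomputable section

open scoped ContDiff Topology
open Complex

namespace Summit.SmoothPoincare4.SmoothPoincare4.Cruxes.TameOrBrodyR4.Sketch

namespace ConjugateBeltrami

/-- The derivative of a `C^∞` map is `C^∞`. -/
theorem contDiff_fderiv_of_infty {f : ℂ → ℂ} (hf : ContDiff ℝ ∞ f) :
    ContDiff ℝ ∞ (fderiv ℝ f) :=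
  (contDiff_infty_iff_fderiv.1 hf).2

/-- For `f` smooth, `η ↦ fderiv ℝ f η v` has derivative `w ↦ fderiv ℝ (fderiv ℝ f) η w v`. -/
theorem hasFDerivAt_fderiv_apply {f : ℂ → ℂ} (hf : ContDiff ℝ ∞ f) (η v : ℂ) :
    HasFDerivAt (fun η => fderiv ℝ f η v) ((fderiv ℝ (fderiv ℝ f) η).flip v) η := by
  have h1 : HasFDerivAt (fderiv ℝ f) (fderiv ℝ (fderiv ℝ f) η) η :=
    ((contDiff_fderiv_of_infty hf).differentiable (by simp) η).hasFDerivAt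
  have h2 := h1.clm_apply (hasFDerivAt_const v η)
  simpa using h2

/-- The final algebraic cancellation behind the conjugate Beltrami equation: with
`gy = jx1g + jA1` (symmetry of second derivatives) and `jAI = jjx1g - A1` (`j ∘ j = -1`),
`½ (½ (A1 - i (jA1 + jx1g)) + i ½ (AI - i (jAI + jxIg))) = ¼ (jxIg + jjx1g)`. -/
theorem algebra_identity {A1 AI jA1 jAI jx1g jxIg jjx1g : ℂ}
    (hgy : AI = jx1g + jA1) (hjAI : jAI = jjx1g - A1) :
    (2 : ℂ)⁻¹ * ((2 : ℂ)⁻¹ * (A1 - I * (jA1 + jx1g)) +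
        I * ((2 : ℂ)⁻¹ * (AI - I * (jAI + jxIg)))) =
      (4 : ℂ)⁻¹ * (jxIg + jjx1g) := by
  linear_combination ((4 : ℂ)⁻¹ * I) * hgy + (-(4 : ℂ)⁻¹ * I * I) * hjAI +
    ((4 : ℂ)⁻¹ * (A1 - jjx1g - jxIg)) * Complex.I_mul_I

end ConjugateBeltrami

open ConjugateBeltrami in
/-- (G3) conjugate Beltrami equation for `G = ½ (1 - i j) ∂ₓ f`: for `f : ℂ → ℂ` smooth and
quasi-holomorphic for a smooth field `j` of complex structures (`j η ∘ j η = -1`,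
`df_η (i v) = j η (df_η v)`), the map `G η = ½ (∂ₓ f η - i j η (∂ₓ f η))` is smooth and
`∂̄ G = ¼ ((∂_y j) (∂ₓ f) + j ((∂ₓ j) (∂ₓ f)))`. -/
theorem helper_conjugateBeltrami (f : ℂ → ℂ) (j : ℂ → (ℂ →L[ℝ] ℂ))
    (hf : ContDiff ℝ ∞ f) (hj : ContDiff ℝ ∞ j)
    (hjj : ∀ η v, j η (j η v) = -v)
    (hstr : ∀ η v, fderiv ℝ f η (Complex.I * v) = j η (fderiv ℝ f η v)) :
    ContDiff ℝ ∞ (fun η => (2 : ℂ)⁻¹ * (fderiv ℝ f η 1 - Complex.I * j η (fderiv ℝ f η 1))) ∧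
    ∀ η : ℂ, Literature.Analysis.Complex.dbarAlong 1
        (fun η => (2 : ℂ)⁻¹ * (fderiv ℝ f η 1 - Complex.I * j η (fderiv ℝ f η 1))) η =
      (4 : ℂ)⁻¹ * (fderiv ℝ j η Complex.I (fderiv ℝ f η 1) +
        j η (fderiv ℝ j η 1 (fderiv ℝ f η 1))) := by
  -- smoothness of `fderiv ℝ f`, of `g = ∂ₓ f` and of `j g`
  have hdf : ContDiff ℝ ∞ (fderiv ℝ f) := contDiff_fderiv_of_infty hf
  have hg : ContDiff ℝ ∞ (fun η => fderiv ℝ f η 1) := hdf.clm_apply contDiff_const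
  have hjg : ContDiff ℝ ∞ (fun η => j η (fderiv ℝ f η 1)) := hj.clm_apply hg
  refine ⟨contDiff_const.mul (hg.sub (contDiff_const.mul hjg)), fun η => ?_⟩
  -- first derivatives at `η` of `g`, `j`, `j g` and `G`
  have hdg : ∀ v : ℂ,
      HasFDerivAt (fun η => fderiv ℝ f η v) ((fderiv ℝ (fderiv ℝ f) η).flip v) η :=
    fun v => hasFDerivAt_fderiv_apply hf η v
  have hdj : HasFDerivAt j (fderiv ℝ j η) η := (hj.differentiable (by simp) η).hasFDerivAt
  have hdjg : HasFDerivAt (fun η => j η (fderiv ℝ f η 1))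
      ((j η).comp ((fderiv ℝ (fderiv ℝ f) η).flip 1) +
        (fderiv ℝ j η).flip (fderiv ℝ f η 1)) η :=
    hdj.clm_apply (hdg 1)
  have hdG : HasFDerivAt
      (fun η => (2 : ℂ)⁻¹ * (fderiv ℝ f η 1 - Complex.I * j η (fderiv ℝ f η 1)))
      ((2 : ℂ)⁻¹ • ((fderiv ℝ (fderiv ℝ f) η).flip 1 -
        Complex.I • ((j η).comp ((fderiv ℝ (fderiv ℝ f) η).flip 1) +
          (fderiv ℝ j η).flip (fderiv ℝ f η 1)))) η :=
    ((hdg 1).sub (hdjg.const_mul Complex.I)).const_mul (2 : ℂ)⁻¹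
  -- `∂_y f = j (∂ₓ f)` as functions, hence `∂_y g = ∂ₓ (∂_y f) = (∂ₓ j) g + j (∂ₓ g)`
  have hsymm : fderiv ℝ (fderiv ℝ f) η Complex.I 1 = fderiv ℝ (fderiv ℝ f) η 1 Complex.I :=
    (hf.contDiffAt.isSymmSndFDerivAt (by
      rw [minSmoothness_of_isRCLikeNormedField]
      exact WithTop.coe_le_coe.2 le_top)) Complex.I 1
  have hfun : (fun η => fderiv ℝ f η Complex.I) = fun η => j η (fderiv ℝ f η 1) := by
    funext η
    simpa using hstr η 1
  have hgy : fderiv ℝ (fderiv ℝ f) η Complex.I 1 =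
      fderiv ℝ j η 1 (fderiv ℝ f η 1) + j η (fderiv ℝ (fderiv ℝ f) η 1 1) := by
    rw [hsymm]
    have h1 := (hdg Complex.I).fderiv
    rw [hfun, hdjg.fderiv] at h1
    have h2 := congrArg (fun L : ℂ →L[ℝ] ℂ => L 1) h1
    simp only [add_apply, ContinuousLinearMap.comp_apply,
      ContinuousLinearMap.flip_apply] at h2
    rw [← h2, add_comm]
  -- `j (∂_y g) = j ((∂ₓ j) g) - ∂ₓ g`
  have hjAI : j η (fderiv ℝ (fderiv ℝ f) η Complex.I 1) =
      j η (fderiv ℝ j η 1 (fderiv ℝ f η 1)) - fderiv ℝ (fderiv ℝ f) η 1 1 := by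
    rw [hgy, map_add, hjj, sub_eq_add_neg]
  -- unfold `∂̄` and the derivative of `G`, then conclude by the algebraic identity
  rw [Literature.Analysis.Complex.dbarAlong_one, hdG.fderiv]
  simp only [smul_apply, sub_apply, add_apply, ContinuousLinearMap.comp_apply,
    ContinuousLinearMap.flip_apply, smul_eq_mul]
  exact algebra_identity hgy hjAI

end Summit.SmoothPoincare4.SmoothPoincare4.Cruxes.TameOrBrodyR4.Sketch
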